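import Summits.CriticalPhenomena.PercolationContinuityZ3.Theorems.PercNearOneGluingNoHeavyQuantConvWindow
import Summits.CriticalPhenomena.PercolationContinuityZ3.Theorems.PercNearOneGluingNoHeavyQuantSliceLawSWHolds
import HarnessLib

/-!
# QUANT lane R8, T-DEC: the one-sided convolution closure, UNCONDITIONAL (`SliceClosedWindowT` is the typer's theorem `sliceClosedWindowT_holds`)

builds on p205010 (kernel theorem, internal audit signed; external expert review pending)

Support file (`--supports stmt-CriticalPhenomena-4575`), QUANT lane seat prim-quant-census-1 (gen 20), rung R8 of
`run/shared/lean/prim/quant/LADDER.md`.  Theorems only, standard axioms, no sorries.  Memo `run/shared/lean/prim/quant/prim-quant-census-1/CONV-G20.md` §3.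
`…QuantConvWindow` proved the one-sided convolution closure from `SliceClosedWindowT`; `SliceClosedWindowT` is now a theorem of the tree
(`LawDec.sliceClosedWindowT_holds`, typer prim-quant-stmt g24's `…QuantSliceLawSWHolds`, via census-2 g55's `SliceLawSW`; an independent second
proof of `SliceLawSW` is census-1 g20's `…QuantWindowPairLawSW`); this file composes them.

* **`LawDec.lconv_decAtT_of_window_bdecAtT'`**, **`LawDec.lconv_decAtT_of_window_hdecAtT'`** — unconditional forms.

[this work].  Nothing here is cited as a published result.  The gluing rows served [cite: KozmaNitzan2024, Conjecture 3 (p. 15)]; product measure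
[cite: Grimmett1999, §1.3 p. 10].
-/

noncomputable section

namespace Summit.CriticalPhenomena.PercolationContinuityZ3.Theorems

namespace Quant

open Finset

namespace LawDec

/-- **ONE-SIDED CONVOLUTION CLOSURE OF DEC, unconditional**: `μ₁` DEC(T₁,·) on the window `[j′ − M₂, j′]`, `μ₂` with a datum at `(T₂, j′)`
without light straddlers relative to `M₁` ⟹ `lconv M₁ M₂ μ₁ μ₂ ∈ D(T₁ + T₂, j′)`. [this work] -/
theorem lconv_decAtT_of_window_bdecAtT' (x T₁ T₂ : ℝ) (j' M₁ M₂ : ℕ) (μ₁ μ₂ : ℕ → ℝ) (hx0 : 0 < x) (hx1 : x < 1)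
    (h10 : ∀ h, 0 ≤ μ₁ h) (h1M : ∀ h, M₁ < h → μ₁ h = 0) (h11 : ∑ h ∈ Finset.range (M₁ + 1), μ₁ h = 1)
    (hwin : ∀ j'', j'' ≤ j' → j' ≤ j'' + M₂ → DECAtT x T₁ j'' M₁ μ₁) (hμ₂ : BDECAtT x T₂ j' M₂ M₁ μ₂) :
    DECAtT x (T₁ + T₂) j' (M₁ + M₂) (lconv M₁ M₂ μ₁ μ₂) :=
  lconv_decAtT_of_window_bdecAtT sliceClosedWindowT_holds x T₁ T₂ j' M₁ M₂ μ₁ μ₂ hx0 hx1 h10 h1M h11 hwin hμ₂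

/-- **the heavy-datum case, unconditional.** [this work] -/
theorem lconv_decAtT_of_window_hdecAtT' (x T₁ T₂ : ℝ) (j' M₁ M₂ : ℕ) (μ₁ μ₂ : ℕ → ℝ) (hx0 : 0 < x) (hx1 : x < 1)
    (h10 : ∀ h, 0 ≤ μ₁ h) (h1M : ∀ h, M₁ < h → μ₁ h = 0) (h11 : ∑ h ∈ Finset.range (M₁ + 1), μ₁ h = 1)
    (hwin : ∀ j'', j'' ≤ j' → j' ≤ j'' + M₂ → DECAtT x T₁ j'' M₁ μ₁) (hμ₂ : HDECAtT x T₂ j' M₂ μ₂) :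
    DECAtT x (T₁ + T₂) j' (M₁ + M₂) (lconv M₁ M₂ μ₁ μ₂) :=
  lconv_decAtT_of_window_hdecAtT sliceClosedWindowT_holds x T₁ T₂ j' M₁ M₂ μ₁ μ₂ hx0 hx1 h10 h1M h11 hwin hμ₂

end LawDec

end Quant

end Summit.CriticalPhenomena.PercolationContinuityZ3.Theorems
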